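import Literature.MathematicalPhysics.QuantumFieldTheory.Balaban1983to89.B13Lemma3TorusBinders
import Literature.MathematicalPhysics.QuantumFieldTheory.Balaban1983to89.B13Lemma3TorusPrimitivePoly

/-!
# `Balaban1983to89.B13Lemma3TorusBindersHolo` — T. Bałaban, *Renormalization group approach to lattice gauge field theories. II.
Cluster expansions*, Commun. Math. Phys. **116** (1988) 1–22 [Balaban1988RG2Cluster], pp. 15–17 with Lemma 2 p. 11: (2.26) for one term
of the two-scale TORUS model from the primitive kernels AND LEMMA 2 OF THE RECORD, WITHOUT the two regularity hypotheses `hΨσ`, `hΨτ` —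
the twin of `B13Lemma3TorusBinders.h226_torus_of_primitives_of_lemma2` over the cell-gaps joiner
`B13Lemma3TorusPrimitivePoly.h226_torus_of_primitives_holo_polyτ`, with (2.20) DERIVED ON AN OPEN PER-DOMAIN τ-REGION (the discs of radii
`2|τ(Y)|`) at the price of a factor 2 on print's letters `a₂₀`, `w`

statement-level skeleton of published theorems with citation tags; kernel-checked compositions of tree theorems; nothing here is a
claim about the Yang–Mills mass gap.

WHY (cell `pub-ymgap`, D-0062 Track A, node N10 = [Balaban1988RG2Cluster] Lemmas 1–3; seat `dag-n10-c` g2, module 13 — third storey of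
the `hΨσ ∕ hΨτ`-free re-issue of N10's torus chain; storeys 1–2 = `B13PrimitiveKernels216Holo`, module 11).  `B13Lemma3TorusBinders`
(p410704 lineage) DISCHARGES the Lemma-2 binders of the (2.26) capstone: (2.22) from the product structure of the (2.3) characteristic
functions, and (2.18)–(2.20) AT THE CONTOUR RADII `|τ(Y)| = (invTau c (d_k Y))⁻¹` from (1.42)∕(1.43)∕(1.36)-for-V″ of the torus step
through the small-field truncation of the potentials.  Deriving `hΨτ` (separate holomorphy in τ) instead of assuming it needs (2.20) on
an OPEN region strictly containing the closed contour discs (holomorphy under the integral sign, `B13Core214Holomorphic`), where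
`sup |τ(Y)|` necessarily EXCEEDS the radius — the located junction recorded in module 11's header.  THIS FILE makes the cheapest honest
choice: the τ-region of the domain `Y` is the OPEN disc of radius `2|τ(Y)|`; on it (2.20) holds with print's letters DOUBLED,
`a₂₀ = 2·m′α₄M⁻⁴(1 + 32∕(κ₁−1))⁴`, `w = 2·K₀(64,8)α₄#(⋃𝐃)` (one line from the radii bound), and the Cauchy circles around `[0,1]` fit
inside as soon as the Cauchy radius is `r ≤ 1` (`|τ(Y)| ≥ 2`); print absorbs such factors in the `O(1)` of (2.20) and in `O(α₅)`.

THE HONEST TRADE relative to `h226_torus_of_primitives_of_lemma2` (binders otherwise verbatim and in the same order, same conclusion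
`‖(2.14)‖ ≤ weight L M c Z a t · e^{a₅|Z|}`).  REMOVED: `hΨσ`, `hΨτ`, and the region binders `Uσ Uτ hUσ hUτ hUexp hUtau hsubτ hr'`.  ADDED:
a second constants record `cp` with `hκp : c.κ₁ < cp.κ₁` (only its `κ₁` is read: the open σ-polydisc is the `e^{cp.κ₁}`-ball), `hr1 : r ≤ 1`,
entrywise σ-holomorphy of `A(σ)`, `G(σ)` on the open `e^{cp.κ₁}`-polydisc (`hAhol hGhol`), measurability of `χ_{k,Y₀}` (`hχm`), of the
potentials `𝐕(Y,·)` (`hVm`) and of the small-field region `{B | ∀ Y ∈ 𝐃, emb B ∈ (1.34)_Y}` in the bond variables (`hsmallm`; the truncation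
that (1.43) forces — print never integrates outside the small fields because `χ_{k,Y₀}` vanishes there, `hχsupp`); measurability of
`χᶜ_{k,P} = Π_b χ(r_P ≤ |B(b)|)` is PROVED from its product form.  CHANGED: the σ-letters `hAs hA hlin hG hCs hdΓ hdC hdE` are asked on the
CLOSED `e^{cp.κ₁}`-polydisc (print p. 15's bigger analyticity space); `a₂₀ ↦ 2a₂₀` inside `hαc ∕ hsmall ∕ hvol` and `w ↦ 2w` inside `hvol`.

NEXT STOREYS (successor; same re-keying by `exact`): `B13NodeTorusKernel216.{h226_torus_of_kernel216_of_lemma2, termwise226_of_kernel216,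
b13Leaf_twoTorus_kernel216}` with `Kernel216 ∕ Localisation17a ∕ Differences216` at `cp`, then this seat's walks leaves ₁…₄ with NODE A's rung
(`TermWalks ∕ TermWalksRef`) for kernels tagged at `cp` (`TermKernels` is phantom in its constants record) and `hAs hlin` on the bigger
polydisc, `hAhol hGhol hχm hVm hsmallm` added, `a₂₀, w` doubled in the displayed numerics.

CITATIONS.  [Balaban1988RG2Cluster] Lemma 2 p. 11, (1.42)–(1.43) p. 11, (2.3) p. 12, (2.14)–(2.15) p. 15, (2.16)–(2.22) p. 16, (2.23)–(2.26)
p. 17; p. 15 (analyticity in σ(Z), τ; constants α′₀, α′₁).  [Balaban1987RG1] p. 251 (periodic carrier), p. 257 (connected families).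

HONEST FRAMING: kernel bookkeeping joining tree interfaces by name + one line of arithmetic + elementary measurability; every kernel family,
the torus step's Lemma-2 data and every number is a HYPOTHESIS; nothing of Bałaban's `Γ_k(Z₀,σ)`, `C^{(k)}(Z₀,σ)`, `𝐕_k` is constructed or
asserted; count-neutral Track-A side landing; N10 NOT discharged; (D4) unchanged; one finite T⁴ programme at fixed ε; nothing continuum ∕
ℝ⁴ ∕ OS ∕ mass-gap ∕ Clay.  0 `sorry`, 0 `def`, no instance, no notation, standard axioms.
-/

noncomputable section

namespace Literature.MathematicalPhysics.QuantumFieldTheory.Balaban1983to89.B13Lemma3TorusBindersHolo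

open Finset Metric
open Literature.MathematicalPhysics.QuantumFieldTheory.Balaban1983to89
open Literature.MathematicalPhysics.QuantumFieldTheory.Balaban1983to89.TreeLengthTorus
open Literature.MathematicalPhysics.QuantumFieldTheory.Balaban1983to89.B12TreeDecay (kappa₀ K₀)
open Literature.MathematicalPhysics.QuantumFieldTheory.Balaban1983to89.B13Lemma3Torus (TwoTorusStep)
open Literature.MathematicalPhysics.QuantumFieldTheory.Balaban1983to89.B13Bound143 (invTau R12)
open Literature.MathematicalPhysics.QuantumFieldTheory.Balaban1983to89.B5TorusCover (UT)
open Literature.MathematicalPhysics.QuantumFieldTheory.Balaban1983to89.B9Thm37GlueTorus (tdist1)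
open Literature.MathematicalPhysics.QuantumFieldTheory.Balaban1983to89.B13Term214 (term214 SepHolOn core214 F214)
open Literature.MathematicalPhysics.QuantumFieldTheory.Balaban1983to89.B13Lemma3TorusData (TBond)
open Literature.MathematicalPhysics.QuantumFieldTheory.Balaban1983to89.B13Lemma3TorusTerms (weight Z0)
open Literature.MathematicalPhysics.QuantumFieldTheory.Balaban1983to89.TreeLengthTorusTransfer (tclosure)
open Literature.MathematicalPhysics.QuantumFieldTheory.Balaban1983to89.B13Ineq220Torus (h220R_of_small F214_congr_of_small)
open Literature.MathematicalPhysics.QuantumFieldTheory.Balaban1983to89.B13Lemma3TorusBinders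
  (h222_of_charFns sum_sq_le_dotProduct sum_tau_norm_V_le_of_lemma2_cubes)
open Literature.MathematicalPhysics.QuantumFieldTheory.Balaban1983to89.B13Lemma3TorusPrimitivePoly
  (h226_torus_of_primitives_holo_polyτ)

section Joiner

variable {L N' : ℕ} [NeZero L] [NeZero N'] {M : ℕ}
variable {ν : ℕ} {Nf : Fin ν → ℕ} [∀ i, NeZero (Nf i)]
variable {Λ : Type} [Fintype Λ] [DecidableEq Λ] {C₀ : Type} [Fintype C₀] [DecidableEq C₀]

open Matrix

open Classical in
/-- **(2.26) FOR ONE TERM OF THE TORUS MODEL FROM THE PRIMITIVE KERNELS AND LEMMA 2 OF THE RECORD, WITHOUT `hΨσ ∕ hΨτ`.**  Exactly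
`B13Lemma3TorusBinders.h226_torus_of_primitives_of_lemma2` (same conclusion, binders in the same order) except: the separate-analyticity
binders `hΨσ hΨτ` and the region binders `Uσ Uτ hUσ hUτ hUexp hUtau hsubτ hr'` are REMOVED; ADDED are a second constants record `cp`
(`hκp : c.κ₁ < cp.κ₁`; the open σ-polydisc is the `e^{cp.κ₁}`-ball), `hr1 : r ≤ 1`, entrywise σ-holomorphy of `A(σ)` and `G(σ)` there
(`hAhol`, `hGhol`), measurability of `χ_{k,Y₀}`, of the potentials and of the small-field region in the bond variables (`hχm hVm hsmallm`);
the σ-letters `hAs hA hlin hG hCs hdΓ hdC hdE` are asked on the CLOSED `e^{cp.κ₁}`-polydisc; print's letters `a₂₀ = m′α₄M⁻⁴(1+32∕(κ₁−1))⁴`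
and `w = K₀(64,8)α₄#(⋃𝐃)` enter `hαc ∕ hsmall ∕ hvol` DOUBLED — (2.20) is derived on the open τ-discs of radii `2|τ(Y)|` from its value
at the radii (Lemma 2's (1.42)∕(1.43) through `sum_tau_norm_V_le_of_lemma2_cubes`, the small-field truncation invisible under
`χ_{k,Y₀}`), on which the (2.14) X-integral is then holomorphic in τ; the Cauchy circles around `[0,1]` fit since `r ≤ 1 < 2 ≤ |τ(Y)|`.
Proof: `B13Lemma3TorusPrimitivePoly.h226_torus_of_primitives_holo_polyτ` at `Uσ := ball 0 (e^{cp.κ₁})`, `Uτ Y := ball 0 (2|τ(Y)|)`.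
[cite: Balaban1988RG2Cluster, (2.14)–(2.26) pp.15–17, Lemma 2 p.11] -/
theorem h226_torus_of_primitives_of_lemma2_holo (c : B13.Consts) (hκ₁1 : 1 ≤ c.κ₁) (hα₆ : c.α₆ ≠ 0)
    -- Lemma 2 of the record at the torus step, and the numbers of (2.18)–(2.20)
    (W : TwoTorusStep 4 L N') (hrepr : B13.Repr142 W.toStepData) (h143 : B13.Bound143 W.toStepData c)
    (h136 : B13.Bound136 W.toStepData c W.Vpp) (hvolk : ∀ Y, W.volk Y = Y.1.card)
    (h12 : R12 c) (hC₃ : 0 ≤ c.C₃) (hE : 0 < c.E₀) (hε : 0 < c.ε₁) (hC₁ : 0 < c.C₁) (hα : 0 < c.α₄)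
    (hM : 1 ≤ c.M) (hκ₁ : 1 + 4 * Real.log 162 ≤ c.κ₁) (hδκ : 64 * Real.log 162 ≤ c.δ * c.κ)
    (Z : TDom 4 N') (t : Finset (TDom 4 (L * N')) × Finset (TBond 4 M (L * N')))
    (hpos : ∀ Y : TDom 4 (L * N'), 0 < invTau c ((tsys 4 (L * N')).dj Y))
    (hhalf : ∀ Y : TDom 4 (L * N'), invTau c ((tsys 4 (L * N')).dj Y) ≤ 1 / 2)
    -- the bigger σ-polydisc (a second constants record lending its `κ₁`) and a Cauchy radius `r ≤ 1`; the τ-regions are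
    -- the open discs of radii `2|τ(Y)|` (chosen inside; no `Uτ`, `hUtau`, `hsubτ` binders)
    (cp : B13.Consts) (hκp : c.κ₁ < cp.κ₁) {r : ℝ} (hr : 0 < r) (hr1 : r ≤ 1)
    (lZ : List (TPt 4 N')) (hlZ : lZ.Nodup ∧ lZ.toFinset = Z.1 \ tclosure L N' (Z0 M t))
    (lD : List (TDom 4 (L * N'))) (hlD : lD.Nodup ∧ lD.toFinset = t.1)
    (A : (TPt 4 N' → ℂ) → Matrix Λ Λ ℂ) (Γ : (TPt 4 N' → ℂ) → (Λ ⊕ C₀ → ℝ) → (Λ → ℂ))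
    -- the (2.3) characteristic functions: χ_{Y₀} ∈ [0,1] supported on the small fields, χᶜ_P = Π indicators
    (χY₀ χcP : (Λ → ℝ) → ℝ) (hχ0 : ∀ B, 0 ≤ χY₀ B) (hχ1 : ∀ B, χY₀ B ≤ 1)
    (P : Finset Λ) (hPcard : P.card = t.2.card) {rP : ℝ} (hrP : 0 ≤ rP)
    (hχc : ∀ B, χcP B = ∏ b ∈ P, (if rP ≤ |B b| then (1 : ℝ) else 0))
    (Dfam : Finset (TDom 4 (L * N'))) (V : TDom 4 (L * N') → (Λ → ℝ) → ℂ)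
    -- the record's objects behind the term: bonds, cubes, the real field inside the configurations, the potentials
    (ι : Λ → W.Bond) (hι : Function.Injective ι) (cube : W.Bond → TPt 4 (L * N'))
    (hQsupp : ∀ (Y : TDom 4 (L * N')) φ b b', W.Q Y φ b b' ≠ 0 → cube b ∈ Y.1 ∧ cube b' ∈ Y.1)
    {m' : ℕ} (hfibc : ∀ a : TPt 4 (L * N'), (univ.filter fun j => cube (ι j) = a).card ≤ m')
    (emb : (Λ → ℝ) → W.Φ) (hBv : ∀ B b, W.Bv (emb B) (ι b) = (B b : ℂ))
    (hBv0 : ∀ B b', b' ∉ Set.range ι → W.Bv (emb B) b' = 0)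
    (hV : ∀ Y ∈ Dfam, ∀ B, emb B ∈ W.sp1 Y → V Y B = W.V Y (emb B))
    (hχsupp : ∀ B, χY₀ B ≠ 0 → ∀ Y ∈ Dfam, emb B ∈ W.sp1 Y)
    -- REPLACES the separate analyticity `hΨσ ∕ hΨτ`: entrywise σ-holomorphy of `A(σ)` on the OPEN `e^{κ₁⁺}`-polydisc,
    -- measurability of `χ_{k,Y₀}`, of the potentials and of the small-field region in the bond variables
    (hAhol : ∀ i j, DifferentiableOn ℂ (fun σ => A σ i j)
      {σ : TPt 4 N' → ℂ | ∀ j, σ j ∈ Metric.ball (0 : ℂ) (Real.exp cp.κ₁)})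
    (hχm : Measurable χY₀) (hVm : ∀ Y, Measurable (V Y))
    (hsmallm : MeasurableSet {B : Λ → ℝ | ∀ Y ∈ Dfam, emb B ∈ W.sp1 Y})
    {C : Matrix Λ Λ ℝ} (hC : C.PosDef) (Γ₀ : Matrix Λ (Λ ⊕ C₀) ℝ)
    (hAs : ∀ σ : TPt 4 N' → ℂ, (∀ j, ‖σ j‖ ≤ Real.exp cp.κ₁) → (A σ).IsSymm)
    (hA : ∀ σ : TPt 4 N' → ℂ, (∀ j, ‖σ j‖ ≤ Real.exp cp.κ₁) → ((A σ).map Complex.re).PosDef)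
    (G : (TPt 4 N' → ℂ) → Matrix Λ (Λ ⊕ C₀) ℂ)
    (hlin : ∀ σ : TPt 4 N' → ℂ, (∀ j, ‖σ j‖ ≤ Real.exp cp.κ₁) →
      ∀ X : Λ ⊕ C₀ → ℝ, Γ σ X = G σ *ᵥ fun j => (X j : ℂ))
    (hGhol : ∀ i j, DifferentiableOn ℂ (fun σ => G σ i j)
      {σ : TPt 4 N' → ℂ | ∀ j, σ j ∈ Metric.ball (0 : ℂ) (Real.exp cp.κ₁)})
    {γ₂ : ℝ} (hγ₂ : 0 ≤ γ₂)
    -- bonds located on the torus `UT Nf` (for the kernel letters)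
    (locΛ : Λ → UT Nf) (locN : Λ ⊕ C₀ → UT Nf) {m : ℕ}
    (hfibΛ : ∀ x : UT Nf, (Finset.univ.filter fun i => locΛ i = x).card ≤ m)
    (hfibN : ∀ x : UT Nf, (Finset.univ.filter fun j => locN j = x).card ≤ m)
    -- rates and constants
    {kap kap' kap'' θ θE θΓ θC KG KΓ KCs K₀' : ℝ} (hkap'' : 0 < kap'') (h1 : kap'' < kap') (h2 : kap' < kap)
    (hθE : 0 ≤ θE) (hθΓ : 0 ≤ θΓ) (hθC : 0 ≤ θC) (hKG : 0 ≤ KG) (hKΓ : 0 ≤ KΓ) (hKCs : 0 ≤ KCs) (hK₀ : 0 ≤ K₀')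
    (hθEle : θE ≤ θ) (hθΓle : θΓ ≤ θ)
    (hθR1le : (m * (1 + 2 / (kap - kap')) ^ ν) * (m * (1 + 2 / (kap' - kap'')) ^ ν)
      * (θΓ * KCs * KG + KΓ * θC * KG + KΓ * K₀' * θΓ) ≤ θ)
    -- uniform localisation of the primitive kernels in the torus distance (L17a)
    (hG : ∀ σ : TPt 4 N' → ℂ, (∀ j, ‖σ j‖ ≤ Real.exp cp.κ₁) →
      ∀ b j, ‖G σ b j‖ ≤ KG * Real.exp (-(kap * tdist1 Nf (locΛ b) (locN j))))
    (hΓ₀ : ∀ b j, ‖Γ₀ b j‖ ≤ KΓ * Real.exp (-(kap * tdist1 Nf (locΛ b) (locN j))))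
    (hCs : ∀ σ : TPt 4 N' → ℂ, (∀ j, ‖σ j‖ ≤ Real.exp cp.κ₁) →
      ∀ b b', ‖(A σ)⁻¹ b b'‖ ≤ KCs * Real.exp (-(kap * tdist1 Nf (locΛ b) (locΛ b'))))
    (hC216 : ∀ b b', ‖C b b'‖ ≤ K₀' * Real.exp (-(kap * tdist1 Nf (locΛ b) (locΛ b'))))
    -- the (2.16)-type differences of the primitive kernels in the torus distance (L16a)
    (hdΓ : ∀ σ : TPt 4 N' → ℂ, (∀ j, ‖σ j‖ ≤ Real.exp cp.κ₁) →
      ∀ b j, ‖(G σ - Γ₀.map (algebraMap ℝ ℂ)) b j‖ ≤ θΓ * Real.exp (-(kap * tdist1 Nf (locΛ b) (locN j))))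
    (hdC : ∀ σ : TPt 4 N' → ℂ, (∀ j, ‖σ j‖ ≤ Real.exp cp.κ₁) →
      ∀ b b', ‖((A σ)⁻¹ - C.map (algebraMap ℝ ℂ)) b b'‖
        ≤ θC * Real.exp (-(kap * tdist1 Nf (locΛ b) (locΛ b'))))
    (hdE : ∀ σ : TPt 4 N' → ℂ, (∀ j, ‖σ j‖ ≤ Real.exp cp.κ₁) →
      ∀ b b', ‖(A σ - C⁻¹.map (algebraMap ℝ ℂ)) b b'‖ ≤ θE * Real.exp (-(kap * tdist1 Nf (locΛ b) (locΛ b'))))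
    (hsmallKθ : K₀' * (m * (1 + 2 / kap) ^ ν) * (θ * (m * (1 + 2 / kap'') ^ ν)) < 1)
    -- the (2.24)–(2.25) smallness, with `a₂₀ = 2·m′·α₄·M⁻⁴(1 + 32/(κ₁−1))⁴` (the factor 2 = the τ-region's radius ratio)
    {cE g : ℝ} (hc0 : 0 ≤ cE) (hc : ∀ k, hC.1.eigenvalues k ≤ cE)
    (hαc : (2 * (θ * (m * (1 + 2 / kap'') ^ ν)) +
      (γ₂ + 2 * (m' * c.α₄ * (c.M ^ 4)⁻¹ * (1 + 32 / (c.κ₁ - 1)) ^ 4))) * cE ≤ 1 / 2) (hg : 0 ≤ g)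
    (hΓq : ∀ X : Λ ⊕ C₀ → ℝ, (Γ₀ *ᵥ X) ⬝ᵥ (C *ᵥ (Γ₀ *ᵥ X)) ≤ g * (X ⬝ᵥ X))
    (hsmall : (2 * (θ * (m * (1 + 2 / kap'') ^ ν)) +
      (γ₂ + 2 * (m' * c.α₄ * (c.M ^ 4)⁻¹ * (1 + 32 / (c.κ₁ - 1)) ^ 4))) * (1 + 2 * cE * g) ≤ 1 / 2)
    -- constant matching, p. 17, with `w = 2·K₀(64,8)·α₄·#(⋃𝐃)`
    {a a₅ : ℝ} (hPa : a ≤ γ₂ * rP ^ 2)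
    (hvol : 2 * (K₀' * (m * (1 + 2 / kap) ^ ν) * (θ * (m * (1 + 2 / kap'') ^ ν))
              * (1 + (1 - K₀' * (m * (1 + 2 / kap) ^ ν) * (θ * (m * (1 + 2 / kap'') ^ ν)))⁻¹) / 2)
          * (Fintype.card Λ : ℝ)
        + 2 * (K₀ 64 8 * c.α₄ * (((Dfam.image Subtype.val).biUnion id).card : ℝ))
        + (2 * (θ * (m * (1 + 2 / kap'') ^ ν)) +
            (γ₂ + 2 * (m' * c.α₄ * (c.M ^ 4)⁻¹ * (1 + 32 / (c.κ₁ - 1)) ^ 4))) * cE * (Fintype.card Λ : ℝ)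
        + (2 * (θ * (m * (1 + 2 / kap'') ^ ν)) +
            (γ₂ + 2 * (m' * c.α₄ * (c.M ^ 4)⁻¹ * (1 + 32 / (c.κ₁ - 1)) ^ 4))) * (1 + 2 * cE * g)
            * (Fintype.card (Λ ⊕ C₀) : ℝ)
        ≤ a₅ * ((Z.1).card : ℝ)) :
    ‖term214 r lZ lD (core214 A Γ (F214 t.2.card χY₀ χcP Dfam V)) 0 0‖ ≤
      weight L M c Z a t * Real.exp (a₅ * ((Z.1).card : ℝ)) := by
  -- the small-field truncation of the potentials and its invisibility under χ_{Y₀}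
  set V' : TDom 4 (L * N') → (Λ → ℝ) → ℂ :=
    fun Y B => if (∀ Y ∈ Dfam, emb B ∈ W.sp1 Y) then V Y B else 0 with hV'
  have hF : F214 t.2.card χY₀ χcP Dfam V' = F214 t.2.card χY₀ χcP Dfam V :=
    F214_congr_of_small Dfam t.2.card χY₀ χcP V (fun B => ∀ Y ∈ Dfam, emb B ∈ W.sp1 Y)
      fun B hB => by by_contra h; exact hB (hχsupp B h)
  -- (2.20) for the truncated potentials at the radii, for all fields
  have ha0 : 0 ≤ (m' : ℝ) * c.α₄ * (c.M ^ 4)⁻¹ * (1 + 32 / (c.κ₁ - 1)) ^ 4 := by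
    have hM0 : 0 < c.M := by linarith
    have hk : 0 < c.κ₁ - 1 := by linarith [Real.log_pos (show (1 : ℝ) < 162 by norm_num)]
    positivity
  have hw0 : 0 ≤ K₀ 64 8 * c.α₄ * (((Dfam.image Subtype.val).biUnion id).card : ℝ) :=
    mul_nonneg (mul_nonneg (B12TreeDecay.K₀_pos 64 8).le hα.le) (Nat.cast_nonneg _)
  have h220R : ∀ B, ∑ Y ∈ Dfam, (invTau c ((tsys 4 (L * N')).dj Y))⁻¹ * ‖V' Y B‖ ≤
      (m' * c.α₄ * (c.M ^ 4)⁻¹ * (1 + 32 / (c.κ₁ - 1)) ^ 4) / 2 * (B ⬝ᵥ B) +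
        K₀ 64 8 * c.α₄ * (((Dfam.image Subtype.val).biUnion id).card : ℝ) := by
    intro B
    have h := h220R_of_small Dfam (fun Y => (invTau c ((tsys 4 (L * N')).dj Y))⁻¹) V
      (fun B => ∀ Y ∈ Dfam, emb B ∈ W.sp1 Y) ha0 hw0 (fun B hB => ?_) B
    · simpa only [hV'] using h
    have h' := sum_tau_norm_V_le_of_lemma2_cubes W c hrepr h143 h136 hvolk h12 hC₃ hE hε hC₁ hα hM hκ₁ hδκ Dfam ι hι
      cube hQsupp hfibc emb hBv hBv0 V hV B hB
    linarith
  -- the per-domain τ-regions: the OPEN discs of radii `2|τ(Y)|`; (2.20) there with the letters doubled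
  have hR2 : ∀ Y : TDom 4 (L * N'), (2 : ℝ) ≤ (invTau c ((tsys 4 (L * N')).dj Y))⁻¹ := fun Y => by
    rw [le_inv_comm₀ (by norm_num) (hpos Y)]; simpa [one_div] using hhalf Y
  have hR0 : ∀ Y : TDom 4 (L * N'), (0 : ℝ) ≤ (invTau c ((tsys 4 (L * N')).dj Y))⁻¹ := fun Y => by
    linarith [hR2 Y]
  have h220U : ∀ τ : TDom 4 (L * N') → ℂ,
      (∀ Y, τ Y ∈ Metric.ball (0 : ℂ) (2 * (invTau c ((tsys 4 (L * N')).dj Y))⁻¹)) →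
      ∀ B, ∑ Y ∈ Dfam, ‖τ Y‖ * ‖V' Y B‖ ≤
        (2 * (m' * c.α₄ * (c.M ^ 4)⁻¹ * (1 + 32 / (c.κ₁ - 1)) ^ 4)) / 2 * (B ⬝ᵥ B) +
          2 * (K₀ 64 8 * c.α₄ * (((Dfam.image Subtype.val).biUnion id).card : ℝ)) := by
    intro τ hτ B
    calc ∑ Y ∈ Dfam, ‖τ Y‖ * ‖V' Y B‖
        ≤ ∑ Y ∈ Dfam, (2 * (invTau c ((tsys 4 (L * N')).dj Y))⁻¹) * ‖V' Y B‖ :=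
          Finset.sum_le_sum fun Y _ =>
            mul_le_mul_of_nonneg_right (mem_ball_zero_iff.1 (hτ Y)).le (norm_nonneg _)
      _ = 2 * ∑ Y ∈ Dfam, (invTau c ((tsys 4 (L * N')).dj Y))⁻¹ * ‖V' Y B‖ := by
          rw [Finset.mul_sum]; exact Finset.sum_congr rfl fun Y _ => by ring
      _ ≤ 2 * ((m' * c.α₄ * (c.M ^ 4)⁻¹ * (1 + 32 / (c.κ₁ - 1)) ^ 4) / 2 * (B ⬝ᵥ B) +
            K₀ 64 8 * c.α₄ * (((Dfam.image Subtype.val).biUnion id).card : ℝ)) :=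
          mul_le_mul_of_nonneg_left (h220R B) zero_le_two
      _ = _ := by ring
  -- (2.22), the sign of χᶜ, measurability of χᶜ (a finite product of indicators of closed half-spaces) and of V′
  have h222 : ∀ B, χY₀ B * χcP B ≤
      Real.exp (-(γ₂ / 2 * rP ^ 2 * (t.2.card : ℕ)) + γ₂ / 2 * ∑ b ∈ P, B b ^ 2) := by
    intro B
    rw [← hPcard]
    exact h222_of_charFns P hγ₂ hrP χY₀ χcP hχ1 hχc B
  have hχc0 : ∀ B, 0 ≤ χcP B := fun B => by
    rw [hχc]; exact prod_nonneg fun b _ => by split_ifs <;> norm_num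
  have hχcm : Measurable χcP := by
    have e : χcP = fun B => ∏ b ∈ P, (if rP ≤ |B b| then (1 : ℝ) else 0) := funext hχc
    rw [e]
    refine Finset.measurable_prod _ fun b _ => ?_
    refine Measurable.ite ?_ measurable_const measurable_const
    exact measurableSet_le measurable_const (continuous_abs.measurable.comp (measurable_pi_apply b))
  have hVm' : ∀ Y, Measurable (V' Y) := fun Y => Measurable.ite hsmallm (hVm Y) measurable_const
  -- the σ-region glue: closed `e^{κ₁}`-ball ⊆ open `e^{κ₁⁺}`-ball ⊆ closed `e^{κ₁⁺}`-ball
  have hin : ∀ σ : TPt 4 N' → ℂ, (∀ j, σ j ∈ Metric.ball (0 : ℂ) (Real.exp cp.κ₁)) →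
      ∀ j, ‖σ j‖ ≤ Real.exp cp.κ₁ := fun σ hσ j => (mem_ball_zero_iff.1 (hσ j)).le
  have hUexp : Metric.closedBall (0 : ℂ) (Real.exp c.κ₁) ⊆ Metric.ball (0 : ℂ) (Real.exp cp.κ₁) :=
    Metric.closedBall_subset_ball (Real.exp_lt_exp.2 hκp)
  -- the τ-regions contain the contour discs and the Cauchy circles around [0, 1] (`r ≤ 1 < 2 ≤ |τ(Y)|`)
  have hUtau : ∀ Y : TDom 4 (L * N'), Metric.closedBall (0 : ℂ) ((invTau c ((tsys 4 (L * N')).dj Y))⁻¹) ⊆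
      Metric.ball (0 : ℂ) (2 * (invTau c ((tsys 4 (L * N')).dj Y))⁻¹) := fun Y =>
    Metric.closedBall_subset_ball (by linarith [hR2 Y])
  have hsubτ : ∀ Y : TDom 4 (L * N'), ∀ s ∈ Set.uIcc (0 : ℝ) 1,
      Metric.closedBall (s : ℂ) r ⊆ Metric.ball (0 : ℂ) (2 * (invTau c ((tsys 4 (L * N')).dj Y))⁻¹) := by
    intro Y s hs z hz
    rw [Set.uIcc_of_le zero_le_one, Set.mem_Icc] at hs
    rw [Metric.mem_closedBall] at hz
    rw [mem_ball_zero_iff]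
    have h1 : ‖z‖ ≤ ‖z - (s : ℂ)‖ + ‖(s : ℂ)‖ := by
      have := norm_add_le (z - (s : ℂ)) (s : ℂ); simpa using this
    have h2 : ‖(s : ℂ)‖ ≤ 1 := by rw [Complex.norm_real, Real.norm_of_nonneg hs.1]; exact hs.2
    rw [← dist_eq_norm] at h1
    linarith [hR2 Y]
  have hr' : r ≤ Real.exp c.κ₁ - 1 := hr1.trans (by linarith [Real.add_one_le_exp c.κ₁])
  have ha0' : 0 ≤ 2 * ((m' : ℝ) * c.α₄ * (c.M ^ 4)⁻¹ * (1 + 32 / (c.κ₁ - 1)) ^ 4) := by positivity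
  have h := h226_torus_of_primitives_holo_polyτ c hκ₁1 hα₆ Z t hpos hhalf Metric.isOpen_ball (fun _ => Metric.isOpen_ball)
    hUexp hUtau hr hr' hsubτ lZ hlZ lD hlD A Γ χY₀ χcP hχ0 hχc0 Dfam V' hC Γ₀ hAhol hχm hχcm hVm'
    (fun σ hσ => hAs σ (hin σ hσ)) (fun σ hσ => hA σ (hin σ hσ)) G hGhol (fun σ hσ => hlin σ (hin σ hσ))
    (fun B => ∑ b ∈ P, B b ^ 2) h222 hγ₂ (fun B => sum_sq_le_dotProduct P B) ha0' h220U locΛ locN hfibΛ hfibN hkap''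
    h1 h2 hθE hθΓ hθC hKG hKΓ hKCs hK₀ hθEle hθΓle hθR1le (fun σ hσ => hG σ (hin σ hσ)) hΓ₀
    (fun σ hσ => hCs σ (hin σ hσ)) hC216 (fun σ hσ => hdΓ σ (hin σ hσ)) (fun σ hσ => hdC σ (hin σ hσ))
    (fun σ hσ => hdE σ (hin σ hσ)) hsmallKθ hc0 hc hαc hg hΓq hsmall hPa hvol
  rwa [hF] at h

end Joiner

end Literature.MathematicalPhysics.QuantumFieldTheory.Balaban1983to89.B13Lemma3TorusBindersHolo

end
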